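import Literature.AnabelianGeometry.EtaleTheta.Discharge.Sec5Thm57OfConnectedTemperoidYddFamily
import Literature.AnabelianGeometry.EtaleTheta.Discharge.Sec5Thm57ChosenFamily

/-!
# [EtTh] §5, Theorem 5.7 at ALL levels for the genuine connected-base tower (`A_⊙^bs := Ÿ`) from ONE compatible family of transport data (pp. 329–331 / PDF pp. 103–105)

Mochizuki, *The étale theta function …*, Publ. RIMS **45** (2009)
[cite: MochizukiEtTh2009, Thm 5.7 p.330 (PDF p.104); Rmk 4.3.2 p.318–319 (PDF pp.92–93); Lem 5.8 p.331 (PDF p.105)].  Seat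
abc-iut-L2-d4 (gen 4; node `EtTh:Thm5.7`); PROOF-ONLY instantiation of this seat's generic
`ThetaFrobenioidTower.thetaRootPreservedAll_of_chosenFamily` (`Discharge/Sec5Thm57ChosenFamily.lean`) at abc-iut-L2-t4's
§5 tower over the GENUINE connected base `B^temp(Π^tp_X)⁰` with `A_⊙^bs := Ÿ` (`ofConnectedTemperoidFamily` over
`BiKummerSetting.mkOfConnectedTemperoidYddTower`), in the ∃-FORM of the `Ψ`-side inputs: ONE compatible family of
transport data `(α_N, β_N, e_N, D_c^N, D_p^N)_N` — the shape delivered by the cell's producers (abc-iut-w5-d245's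
`exists_unit_transports_ofBiKummerData`: ONE unit `e`, `D_c = 1`, a unit `D_p`, `StrvTransport` for that `e`).
Compared with `thetaRootPreservedAll_ofConnectedTemperoidYddFamily` (p430430) the binders `hdiv` (∀ α β ∃ e), `hdesc`
(∀-form descent) and `hθ₁` (∀-form) are GONE, replaced by the chosen family with its equations (`hT`, `hT'`, `hu`), its
compatibility with the transitions to the first root (`hΨα`, `hΨβ`, `he`) and `θ₁`/`hstrv₁`/`hYdd₁` for THE chosen
level-1 datum; `hc` is stated for THE chosen level-1 discrepancy.  Discharged inside: `hepi` (L1: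
`ThetaFrobenioid.epi_of_model`), the unit law along `β_{1,N}` (`hconst_ofBiKummerFamily'`, modulo `hnat`), the level-1
§5 facts (`facts_ofConnectedTemperoidData` from `hconst₁`, `hgc₁`; `hH` a theorem), `Ψ^Aut(O^×(B_1)) = O^×(B_1)`
(`units_map_psiAut` with the compatible base functor of `exists_compatBase_of_model_slim` — "`D` slim"/"FSM-type" by
`TemperedArithmeticGroup.isSlim_connectedPart` / `connectedPart_isOfFSMType`).  REMAINING binders: `hnd`, `hN`,
`hconst₁`, `hgc₁`, `hnat`, `hfac₁` (genuine-instance properties of the abstract `tf`), the chosen family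
(`αf βf ef Dcf Dpf hT hT' hu hΨα hΨβ he θ₁ hstrv₁ hYdd₁`) and `hc`.
HONEST FRAMING: a kernel-checked implication for data so parametrised (the class `TemperedFrobenioid T₀ (ConnectedPart (BTemp
X.Pi)) VD` is not shown inhabited here); nothing asserts any result of [EtTh] unconditionally; typed ≠ discharged; no side taken
on anything downstream. -/

noncomputable section

namespace Literature.AnabelianGeometry.EtaleTheta

open CategoryTheory Opposite Literature.AlgebraicGeometry.Frobenioids Literature.AnabelianGeometry.SemiGraphs
  Literature.AnabelianGeometry.SemiGraphs.GaloisObjects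

universe u₀ v₀ w

namespace ThetaFrobenioidTower

variable {K : Type u₀} [Field K] {X : SemiGraphs.TemperedArithmeticGroup.{u₀} K} {D₀ : Type u₀} [Category.{v₀} D₀]
  {V : FrdIMonoidStub.{w}} {T₀ : RealifiedDivisorMonoids (D₀ := D₀) V}
  {VD : FrdICatStub.{u₀ + 1, u₀, w} (ConnectedPart (BTemp X.Pi))}
  {tf : TemperedFrobenioid T₀ (ConnectedPart (BTemp X.Pi)) VD} {hZ : tf.monoidType = MonoidType.Z}
  {hP : ∀ A : (ConnectedPart (BTemp X.Pi))ᵒᵖ, IsPerfect (tf.Φ.carrier A)}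
  {NH : Subgroup (Field.absoluteGaloisGroup K) → tf.category → ℕ+ → Prop}
  {E : Set ℕ+} (𝒯 : ThetaEnvTower.{max u₀ w} E) (ιX : 𝒯.PiX ≃ₜ* X.Pi)
  {pullFrac : ∀ {A A' : (BiKummerSetting.mkOfConnectedTemperoidYddTower X tf hZ hP NH 𝒯 ιX).C} (_ : A' ⟶ A),
    (BiKummerSetting.mkOfConnectedTemperoidYddTower X tf hZ hP NH 𝒯 ιX).biratUnits A →
      (BiKummerSetting.mkOfConnectedTemperoidYddTower X tf hZ hP NH 𝒯 ιX).biratUnits A'}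
  {lv : ℕ+}
  {θ : (BiKummerSetting.mkOfConnectedTemperoidYddTower X tf hZ hP NH 𝒯 ιX).biratUnits
    (BiKummerSetting.mkOfConnectedTemperoidYddTower X tf hZ hP NH 𝒯 ιX).Aodot}
  {Bl : (BiKummerSetting.mkOfConnectedTemperoidYddTower X tf hZ hP NH 𝒯 ιX).C}
  {Pl : (BiKummerSetting.mkOfConnectedTemperoidYddTower X tf hZ hP NH 𝒯 ιX).FractionPair θ Bl}
  {Rl : (BiKummerSetting.mkOfConnectedTemperoidYddTower X tf hZ hP NH 𝒯 ιX).NthRoot θ Pl lv pullFrac}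
  (h : ModelFrobenioid.Hypotheses tf.divisorMonoid tf.ratFnFunctor)
  (Q : FrobenioidTheta.ThetaSubquotientStub.{w} (ConnectedPart (BTemp X.Pi))) (odd_l : Odd (lv : ℕ))
  (R : ∀ N : ℕ+, (BiKummerSetting.mkOfConnectedTemperoidYddTower X tf hZ hP NH 𝒯 ιX).NthRoot Rl.root Rl.pair N pullFrac)
  (K' : Type w) [Field K'] (constEmb : ∀ N : ℕ+, K'ˣ →* tf.biratUnitsModel (R N).BN)
  (constEmb_injective : ∀ N : ℕ+, Function.Injective (constEmb N))
  (hinvc : ∀ (N : ℕ+) (g : Aut (R N).AN.base),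
    pull tf.divisorMonoid g.hom (ModelFrobenioid.div (R N).pair.num) = ModelFrobenioid.div (R N).pair.num)
  (hinvp : ∀ (N : ℕ+) (y : 𝒯.PiX), y ∈ 𝒯.PiYdd →
    pull tf.divisorMonoid ((BiKummerSetting.mkOfConnectedTemperoidYddTower X tf hZ hP NH 𝒯 ιX).galoisSurj (R N).AN.base
      (R N).αData.isGalois (ιX y)).hom (ModelFrobenioid.div (R N).pair.den) = ModelFrobenioid.div (R N).pair.den)
  (α : ∀ {N N' : ℕ+}, (N : ℕ) ∣ N' → ((R N').AN ⟶ (R N).AN))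
  (β : ∀ {N N' : ℕ+}, (N : ℕ) ∣ N' → ((R N').BN ⟶ (R N).BN))
  (comm_sCap : ∀ {N N' : ℕ+} (hd : (N : ℕ) ∣ N'), (R N').pair.num ≫ β hd = α hd ≫ (R N).pair.num)
  (comm_sCup : ∀ {N N' : ℕ+} (hd : (N : ℕ) ∣ N'), (R N').pair.den ≫ β hd = α hd ≫ (R N).pair.den)
  (isIsometry_α : ∀ {N N' : ℕ+} (hd : (N : ℕ) ∣ N'),
    ((BiKummerSetting.mkOfConnectedTemperoidYddTower X tf hZ hP NH 𝒯 ιX).sec5Stub h).pre.IsIsometry (α hd))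
  (degFr_α : ∀ {N N' : ℕ+} (hd : (N : ℕ) ∣ N'),
    (((BiKummerSetting.mkOfConnectedTemperoidYddTower X tf hZ hP NH 𝒯 ιX).sec5Stub h).pre.degFr (α hd) : ℕ) * N = N')
  (isIsometry_β : ∀ {N N' : ℕ+} (hd : (N : ℕ) ∣ N'),
    ((BiKummerSetting.mkOfConnectedTemperoidYddTower X tf hZ hP NH 𝒯 ιX).sec5Stub h).pre.IsIsometry (β hd))
  (degFr_β : ∀ {N N' : ℕ+} (hd : (N : ℕ) ∣ N'),
    (((BiKummerSetting.mkOfConnectedTemperoidYddTower X tf hZ hP NH 𝒯 ιX).sec5Stub h).pre.degFr (β hd) : ℕ) * N = N')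
  (baseFrob_α : ∀ {N N' : ℕ+} (hd : (N : ℕ) ∣ N'),
    (BiKummerSetting.mkOfConnectedTemperoidYddTower X tf hZ hP NH 𝒯 ιX).IsOfBaseFrobeniusType (α hd))

include h in
/-- **[EtTh] Theorem 5.7 (root level) at ALL levels for the §5 tower over `B^temp(Π^tp_X)⁰` with `A_⊙^bs := Ÿ`, from ONE
compatible family of transport data** (∃-form `Ψ`-side inputs; see the module docstring for the exact binder list).
[cite: MochizukiEtTh2009, Thm 5.7 p.329–330 (PDF pp.103–104); Rmk 4.3.2 p.318–319 (PDF pp.92–93); Lem 5.8 p.331 (PDF p.105)] -/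
theorem thetaRootPreservedAll_ofConnectedTemperoidYddFamily_ofChosen
    (hnd : IsNonDilatingOn tf.divisorMonoid)
    (hN : ∃ A : (BiKummerSetting.mkOfConnectedTemperoidYddTower X tf hZ hP NH 𝒯 ιX).C, ¬ (PreFrobenioidData.ofModel tf.divisorMonoid tf.ratFnFunctor tf.divBNatTrans).IsGroupLikeObj A)
    (hconst₁ : ∀ (e : Aut (R 1).BN) (k : K'ˣ), tf.biratAutModel (R 1).BN e (constEmb 1 k) = constEmb 1 k)
    (hgc₁ : ∀ u : (ThetaFrobenioid.ofConnectedTemperoidData (T := 𝒯.level ⟨1, 𝒯.one_mem⟩) h Q odd_l (R 1) ιX K' (constEmb 1)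
        (constEmb_injective 1) (hinvc 1) (hinvp 1)).units (ThetaFrobenioid.ofConnectedTemperoidData (T := 𝒯.level ⟨1, 𝒯.one_mem⟩) h Q odd_l (R 1) ιX K' (constEmb 1)
        (constEmb_injective 1) (hinvc 1) (hinvp 1)).BN,
      (∀ y ∈ (ThetaFrobenioid.ofConnectedTemperoidData (T := 𝒯.level ⟨1, 𝒯.one_mem⟩) h Q odd_l (R 1) ιX K' (constEmb 1)
        (constEmb_injective 1) (hinvc 1) (hinvp 1)).imPiY, (ThetaFrobenioid.ofConnectedTemperoidData (T := 𝒯.level ⟨1, 𝒯.one_mem⟩) h Q odd_l (R 1) ιX K' (constEmb 1)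
        (constEmb_injective 1) (hinvc 1) (hinvp 1)).sgpCap y * (u : Aut (ThetaFrobenioid.ofConnectedTemperoidData (T := 𝒯.level ⟨1, 𝒯.one_mem⟩) h Q odd_l (R 1) ιX K' (constEmb 1)
        (constEmb_injective 1) (hinvc 1) (hinvp 1)).BN) * ((ThetaFrobenioid.ofConnectedTemperoidData (T := 𝒯.level ⟨1, 𝒯.one_mem⟩) h Q odd_l (R 1) ιX K' (constEmb 1)
        (constEmb_injective 1) (hinvc 1) (hinvp 1)).sgpCap y)⁻¹ = u) → (ThetaFrobenioid.ofConnectedTemperoidData (T := 𝒯.level ⟨1, 𝒯.one_mem⟩) h Q odd_l (R 1) ιX K' (constEmb 1)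
        (constEmb_injective 1) (hinvc 1) (hinvp 1)).unitsToBirat (ThetaFrobenioid.ofConnectedTemperoidData (T := 𝒯.level ⟨1, 𝒯.one_mem⟩) h Q odd_l (R 1) ιX K' (constEmb 1)
        (constEmb_injective 1) (hinvc 1) (hinvp 1)).BN u ∈ (ThetaFrobenioid.ofConnectedTemperoidData (T := 𝒯.level ⟨1, 𝒯.one_mem⟩) h Q odd_l (R 1) ιX K' (constEmb 1)
        (constEmb_injective 1) (hinvc 1) (hinvp 1)).constEmb.range)
    (Ψ : (BiKummerSetting.mkOfConnectedTemperoidYddTower X tf hZ hP NH 𝒯 ιX).C ≌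
      (BiKummerSetting.mkOfConnectedTemperoidYddTower X tf hZ hP NH 𝒯 ιX).C)
    (hnat : ∀ (N : ℕ+) (c : K'ˣ),
      (tf.ratFnFunctor.map (ModelFrobenioid.baseMap (β (one_dvd_level N))).op).hom
          ((constEmb 1 c : tf.biratUnitsModel (R 1).BN) : tf.ratFnFunctor.obj (op (R 1).BN.base)) =
        ((constEmb N c : tf.biratUnitsModel (R N).BN) : tf.ratFnFunctor.obj (op (R N).BN.base)))
    (hfac₁ : ∀ y ∈ ((ofConnectedTemperoidFamily h Q odd_l R ιX K' constEmb constEmb_injective hinvc hinvp α β comm_sCap comm_sCup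
      isIsometry_α degFr_α isIsometry_β degFr_β baseFrob_α).atLevel 1).imPiY, ∃ x ∈ ((ofConnectedTemperoidFamily h Q odd_l R ιX K' constEmb constEmb_injective hinvc hinvp α β comm_sCap comm_sCup
      isIsometry_α degFr_α isIsometry_β degFr_β baseFrob_α).atLevel 1).HB, ∀ u ∈ ((ofConnectedTemperoidFamily h Q odd_l R ιX K' constEmb constEmb_injective hinvc hinvp α β comm_sCap comm_sCup
      isIsometry_α degFr_α isIsometry_β degFr_β baseFrob_α).atLevel 1).units ((ofConnectedTemperoidFamily h Q odd_l R ιX K' constEmb constEmb_injective hinvc hinvp α β comm_sCap comm_sCup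
      isIsometry_α degFr_α isIsometry_β degFr_β baseFrob_α).BN 1),
      (ofConnectedTemperoidFamily h Q odd_l R ιX K' constEmb constEmb_injective hinvc hinvp α β comm_sCap comm_sCup
      isIsometry_α degFr_α isIsometry_β degFr_β baseFrob_α).sgpCap 1 y * u * ((ofConnectedTemperoidFamily h Q odd_l R ιX K' constEmb constEmb_injective hinvc hinvp α β comm_sCap comm_sCup
      isIsometry_α degFr_α isIsometry_β degFr_β baseFrob_α).sgpCap 1 y)⁻¹ = (ofConnectedTemperoidFamily h Q odd_l R ιX K' constEmb constEmb_injective hinvc hinvp α β comm_sCap comm_sCup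
      isIsometry_α degFr_α isIsometry_β degFr_β baseFrob_α).sgpCap 1 x * u * ((ofConnectedTemperoidFamily h Q odd_l R ιX K' constEmb constEmb_injective hinvc hinvp α β comm_sCap comm_sCup
      isIsometry_α degFr_α isIsometry_β degFr_β baseFrob_α).sgpCap 1 x)⁻¹)
    (αf : ∀ N : ℕ+, Ψ.functor.obj ((ofConnectedTemperoidFamily h Q odd_l R ιX K' constEmb constEmb_injective hinvc hinvp α β comm_sCap comm_sCup
      isIsometry_α degFr_α isIsometry_β degFr_β baseFrob_α).AN N) ≅ (ofConnectedTemperoidFamily h Q odd_l R ιX K' constEmb constEmb_injective hinvc hinvp α β comm_sCap comm_sCup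
      isIsometry_α degFr_α isIsometry_β degFr_β baseFrob_α).AN N) (βf : ∀ N : ℕ+, Ψ.functor.obj ((ofConnectedTemperoidFamily h Q odd_l R ιX K' constEmb constEmb_injective hinvc hinvp α β comm_sCap comm_sCup
      isIsometry_α degFr_α isIsometry_β degFr_β baseFrob_α).BN N) ≅ (ofConnectedTemperoidFamily h Q odd_l R ιX K' constEmb constEmb_injective hinvc hinvp α β comm_sCap comm_sCup
      isIsometry_α degFr_α isIsometry_β degFr_β baseFrob_α).BN N)
    (ef : ∀ N : ℕ+, (ofConnectedTemperoidFamily h Q odd_l R ιX K' constEmb constEmb_injective hinvc hinvp α β comm_sCap comm_sCup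
      isIsometry_α degFr_α isIsometry_β degFr_β baseFrob_α).AN N ≅ (ofConnectedTemperoidFamily h Q odd_l R ιX K' constEmb constEmb_injective hinvc hinvp α β comm_sCap comm_sCup
      isIsometry_α degFr_α isIsometry_β degFr_β baseFrob_α).AN N) (Dcf Dpf : ∀ N : ℕ+, Aut ((ofConnectedTemperoidFamily h Q odd_l R ιX K' constEmb constEmb_injective hinvc hinvp α β comm_sCap comm_sCup
      isIsometry_α degFr_α isIsometry_β degFr_β baseFrob_α).BN N))
    (hT : ∀ N : ℕ+, (αf N).inv ≫ Ψ.functor.map ((ofConnectedTemperoidFamily h Q odd_l R ιX K' constEmb constEmb_injective hinvc hinvp α β comm_sCap comm_sCup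
      isIsometry_α degFr_α isIsometry_β degFr_β baseFrob_α).sCap N) ≫ (βf N).hom = (ef N).hom ≫ (ofConnectedTemperoidFamily h Q odd_l R ιX K' constEmb constEmb_injective hinvc hinvp α β comm_sCap comm_sCup
      isIsometry_α degFr_α isIsometry_β degFr_β baseFrob_α).sCap N ≫ (Dcf N).hom)
    (hT' : ∀ N : ℕ+, (αf N).inv ≫ Ψ.functor.map ((ofConnectedTemperoidFamily h Q odd_l R ιX K' constEmb constEmb_injective hinvc hinvp α β comm_sCap comm_sCup
      isIsometry_α degFr_α isIsometry_β degFr_β baseFrob_α).sCup N) ≫ (βf N).hom = (ef N).hom ≫ (ofConnectedTemperoidFamily h Q odd_l R ιX K' constEmb constEmb_injective hinvc hinvp α β comm_sCap comm_sCup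
      isIsometry_α degFr_α isIsometry_β degFr_β baseFrob_α).sCup N ≫ (Dpf N).hom)
    (hu : ∀ N : ℕ+, (Dcf N)⁻¹ * Dpf N ∈ ((ofConnectedTemperoidFamily h Q odd_l R ιX K' constEmb constEmb_injective hinvc hinvp α β comm_sCap comm_sCup
      isIsometry_α degFr_α isIsometry_β degFr_β baseFrob_α).atLevel N).units ((ofConnectedTemperoidFamily h Q odd_l R ιX K' constEmb constEmb_injective hinvc hinvp α β comm_sCap comm_sCup
      isIsometry_α degFr_α isIsometry_β degFr_β baseFrob_α).BN N))
    (hΨα : ∀ N : ℕ+,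
      (αf N).inv ≫ Ψ.functor.map ((ofConnectedTemperoidFamily h Q odd_l R ιX K' constEmb constEmb_injective hinvc hinvp α β comm_sCap comm_sCup
      isIsometry_α degFr_α isIsometry_β degFr_β baseFrob_α).α (one_dvd_level N)) ≫ (αf 1).hom = (ofConnectedTemperoidFamily h Q odd_l R ιX K' constEmb constEmb_injective hinvc hinvp α β comm_sCap comm_sCup
      isIsometry_α degFr_α isIsometry_β degFr_β baseFrob_α).α (one_dvd_level N))
    (hΨβ : ∀ N : ℕ+,
      (βf N).inv ≫ Ψ.functor.map ((ofConnectedTemperoidFamily h Q odd_l R ιX K' constEmb constEmb_injective hinvc hinvp α β comm_sCap comm_sCup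
      isIsometry_α degFr_α isIsometry_β degFr_β baseFrob_α).β (one_dvd_level N)) ≫ (βf 1).hom = (ofConnectedTemperoidFamily h Q odd_l R ιX K' constEmb constEmb_injective hinvc hinvp α β comm_sCap comm_sCup
      isIsometry_α degFr_α isIsometry_β degFr_β baseFrob_α).β (one_dvd_level N))
    (he : ∀ N : ℕ+, (ofConnectedTemperoidFamily h Q odd_l R ιX K' constEmb constEmb_injective hinvc hinvp α β comm_sCap comm_sCup
      isIsometry_α degFr_α isIsometry_β degFr_β baseFrob_α).α (one_dvd_level N) ≫ (ef 1).hom = (ef N).hom ≫ (ofConnectedTemperoidFamily h Q odd_l R ιX K' constEmb constEmb_injective hinvc hinvp α β comm_sCap comm_sCup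
      isIsometry_α degFr_α isIsometry_β degFr_β baseFrob_α).α (one_dvd_level N))
    (θ₁ : Aut ((ofConnectedTemperoidFamily h Q odd_l R ιX K' constEmb constEmb_injective hinvc hinvp α β comm_sCap comm_sCup
      isIsometry_α degFr_α isIsometry_β degFr_β baseFrob_α).pre.base.obj ((ofConnectedTemperoidFamily h Q odd_l R ιX K' constEmb constEmb_injective hinvc hinvp α β comm_sCap comm_sCup
      isIsometry_α degFr_α isIsometry_β degFr_β baseFrob_α).BN 1)) ≃* Aut ((ofConnectedTemperoidFamily h Q odd_l R ιX K' constEmb constEmb_injective hinvc hinvp α β comm_sCap comm_sCup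
      isIsometry_α degFr_α isIsometry_β degFr_β baseFrob_α).pre.base.obj ((ofConnectedTemperoidFamily h Q odd_l R ιX K' constEmb constEmb_injective hinvc hinvp α β comm_sCap comm_sCup
      isIsometry_α degFr_α isIsometry_β degFr_β baseFrob_α).BN 1)))
    (hstrv₁ : ((ofConnectedTemperoidFamily h Q odd_l R ιX K' constEmb constEmb_injective hinvc hinvp α β comm_sCap comm_sCup
      isIsometry_α degFr_α isIsometry_β degFr_β baseFrob_α).atLevel 1).StrvTransport Ψ (αf 1) (ef 1) θ₁)
    (hYdd₁ : ((ofConnectedTemperoidFamily h Q odd_l R ιX K' constEmb constEmb_injective hinvc hinvp α β comm_sCap comm_sCup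
      isIsometry_α degFr_α isIsometry_β degFr_β baseFrob_α).atLevel 1).HB.map θ₁.toMonoidHom = ((ofConnectedTemperoidFamily h Q odd_l R ιX K' constEmb constEmb_injective hinvc hinvp α β comm_sCap comm_sCup
      isIsometry_α degFr_α isIsometry_β degFr_β baseFrob_α).atLevel 1).HB)
    (hc : ∀ c : (ofConnectedTemperoidFamily h Q odd_l R ιX K' constEmb constEmb_injective hinvc hinvp α β comm_sCap comm_sCup
      isIsometry_α degFr_α isIsometry_β degFr_β baseFrob_α).Kˣ, ((ofConnectedTemperoidFamily h Q odd_l R ιX K' constEmb constEmb_injective hinvc hinvp α β comm_sCap comm_sCup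
      isIsometry_α degFr_α isIsometry_β degFr_β baseFrob_α).atLevel 1).unitsToBirat ((ofConnectedTemperoidFamily h Q odd_l R ιX K' constEmb constEmb_injective hinvc hinvp α β comm_sCap comm_sCup
      isIsometry_α degFr_α isIsometry_β degFr_β baseFrob_α).BN 1) ⟨(Dcf 1)⁻¹ * Dpf 1, hu 1⟩ = (ofConnectedTemperoidFamily h Q odd_l R ιX K' constEmb constEmb_injective hinvc hinvp α β comm_sCap comm_sCup
      isIsometry_α degFr_α isIsometry_β degFr_β baseFrob_α).constEmb 1 c →
      c ^ (2 * (ofConnectedTemperoidFamily h Q odd_l R ιX K' constEmb constEmb_injective hinvc hinvp α β comm_sCap comm_sCup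
      isIsometry_α degFr_α isIsometry_β degFr_β baseFrob_α).l) = 1) :
    (ofConnectedTemperoidFamily h Q odd_l R ιX K' constEmb constEmb_injective hinvc hinvp α β comm_sCap comm_sCup
      isIsometry_α degFr_α isIsometry_β degFr_β baseFrob_α).ThetaRootPreservedAll Ψ := by
  have H₁ := ThetaFrobenioid.facts_ofConnectedTemperoidData (T := 𝒯.level ⟨1, 𝒯.one_mem⟩) h Q odd_l (R 1) ιX K'
    (constEmb 1) (constEmb_injective 1) (hinvc 1) (hinvp 1)
    (BiKummerSetting.hH_mkOfConnectedTemperoidYddTower X tf hZ hP NH 𝒯 ιX) hconst₁ hgc₁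
  refine ThetaFrobenioidTower.thetaRootPreservedAll_of_chosenFamily _ Ψ ?_ ?_ H₁.sgpCapSpec H₁.sgpCupSpec
    H₁.biKummerDifferenceMem H₁.constantsActByCyclotome hfac₁ αf βf ef Dcf Dpf hT hT' hu hΨα hΨβ he ?_ θ₁ hstrv₁
    hYdd₁ hc
  · exact ThetaFrobenioid.epi_of_model (DivB := tf.divBNatTrans) h
  · delta ofConnectedTemperoidFamily
    exact hconst_ofBiKummerFamily' h _ Q odd_l R ιX
      (fun N => BiKummerSetting.mkOfConnectedTemperoid_isOpen_ker_galoisSurj X tf hZ hP NH _ _ _ (R N).AN.base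
        (R N).αData.isGalois)
      _ K' constEmb constEmb_injective
      (fun N => ThetaFrobenioid.hdivc_of_pull_invariant h.isDivisorial (R N) (ThetaFrobenioid.strvOfBiKummerData h (R N))
        (ThetaFrobenioid.baseMap_strvOfBiKummerData h (R N)) (hinvc N))
      (div_strv_comp_den_connFamily h R ιX hinvp)
      α β comm_sCap comm_sCup isIsometry_α degFr_α isIsometry_β degFr_β baseFrob_α
      (fun hd => rho_comm_β_of_natural R ιX
        (BiKummerSetting.mkOfConnectedTemperoid_galoisSurj_natural X tf hZ hP NH _ _ _) α β comm_sCap hd) hnat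
  · obtain ⟨Ψbs, hΨbs, ⟨eΨ⟩⟩ := ThetaFrobenioid.exists_compatBase_of_model_slim
      (𝔉 := (ofConnectedTemperoidFamily h Q odd_l R ιX K' constEmb constEmb_injective hinvc hinvp α β comm_sCap comm_sCup
      isIsometry_α degFr_α isIsometry_β degFr_β baseFrob_α).atLevel 1) Ψ rfl h
      QuasiTemperoid.BTempConnected.connectedPart_isOfFSMType (SemiGraphs.TemperedArithmeticGroup.isSlim_connectedPart X)
      hnd hN
    haveI := hΨbs
    exact ThetaFrobenioid.units_map_psiAut (𝔉 := (ofConnectedTemperoidFamily h Q odd_l R ιX K' constEmb constEmb_injective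
      hinvc hinvp α β comm_sCap comm_sCup isIsometry_α degFr_α isIsometry_β degFr_β baseFrob_α).atLevel 1) Ψ (βf 1) Ψbs eΨ

end ThetaFrobenioidTower

end Literature.AnabelianGeometry.EtaleTheta

end
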